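import Summits.CriticalPhenomena.CardyFormulaZ2.Theorems.CardyIKTransportIKLinearTransportTransportDefs

/-!
# `stub_LinearTransport` (crux stmt-CriticalPhenomena-5076, line `pinned-diagram-exchange`) — RESHAPE,
# part 2 of 4: the coupling lift, Part A — the bad event is read on a finite window

Support file (`--supports stmt-CriticalPhenomena-5076`, registered sub-goal `badObs_congr`) of the reshape
`stub_LinearTransport = stripLaw (S₁) → windowTransport (S₂, open) → couplingLift (S₃)` (see the header of
`…TransportDefs`). Piece S₃ `couplingLift` (next file, `…CouplingLift2`) lifts a coupling `π` of the
observables `ν_{S₀}, ν_{S₁}` of two block patterns to a coupling `γ` of `μIK` with `μIK` with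
`γ (badPair K δ ε ρ) ≤ π (badObs K δ ε ρ)`; it is elementary because the bad event reads FINITE window data.
This file is that finiteness (namespace `Lift`):

* `Lift.badObs_congr` — THE BAD EVENT IS READ ON THE WINDOW: two pairs of observable configurations that
  agree (`Lift.Agree`: same cells, same faces) on the sup-ball `ballInf 0 ⌈A/δ⌉₊`,
  `A = Lift.liftScale K ε ρ = |ε| + (‖K‖ + ‖K⁻¹‖ + 1)|ρ| + 2`, lie in `badObs K δ ε ρ` together
  (window cells `‖pos δ v‖ ≤ ρ`; a monochromatic path reads the faces at its cells and below them,
  `Lift.monoPaths_congr`; the cells of a shadow satisfy `‖pos δ w‖ ≤ ε + ‖K‖|ρ|`, resp. `‖K⁻¹‖`,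
  `Lift.norm_pos_le_of_mem_shadows`; `+1` for the faces below, `Lift.mem_ballInf_of_norm_pos_le`;
  the degenerate signs of `ε, ρ` are absorbed by the absolute values);
* the `ℝ≥0∞` rearrangements and the measurability helper used by the gluing formula of `…CouplingLift2`.
-/

noncomputable section

namespace Summit.CriticalPhenomena.CardyFormulaZ2.Theorems.IKLinearTransport.PinnedDiagramExchange

open scoped BigOperators Topology Classical MeasureTheory ProbabilityTheory ENNReal
open Filter Set Function MeasureTheory
open Literature.Probability.Percolation Literature.Probability.LatticeModels
open Literature.Probability.RandomPlanarGeometry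

/-! ## The lift, Part A — the bad event is read on a finite window -/

namespace Lift

/-- Agreement of two observable configurations on the cells and faces of `Λ`. [folklore] -/
def Agree (Λ : Set (Site 2)) (x y : Obs) : Prop :=
  ∀ v ∈ Λ, (v ∈ x.1 ↔ v ∈ y.1) ∧ (v ∈ x.2 ↔ v ∈ y.2)

/-- Agreement is symmetric. [folklore] -/
theorem Agree.symm {Λ : Set (Site 2)} {x y : Obs} (h : Agree Λ x y) : Agree Λ y x :=
  fun v hv => ⟨(h v hv).1.symm, (h v hv).2.symm⟩

/-- The two coordinates of a cell are bounded by the norm of its square embedding. [folklore] -/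
theorem abs_coord_le_norm_sqEmb (v : Site 2) :
    |((v 0 : ℤ) : ℝ)| ≤ ‖sqEmb v‖ ∧ |((v 1 : ℤ) : ℝ)| ≤ ‖sqEmb v‖ := by
  have hre : (sqEmb v).re = (v 0 : ℝ) := by
    simp only [sqEmb, Complex.add_re, Complex.ofReal_re, Complex.mul_re, Complex.I_re, Complex.I_im,
      Complex.ofReal_im, mul_zero, mul_one, sub_zero, add_zero]
  have him : (sqEmb v).im = (v 1 : ℝ) := by
    simp only [sqEmb, Complex.add_im, Complex.ofReal_im, Complex.mul_im, Complex.I_re, Complex.I_im,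
      Complex.ofReal_re, mul_zero, mul_one, add_zero, zero_add]
  constructor
  · rw [← hre]; exact Complex.abs_re_le_norm _
  · rw [← him]; exact Complex.abs_im_le_norm _

/-- A cell whose rescaled position has norm `≤ M` lies, together with the face below it, in the
sup-ball of radius `R` around the origin as soon as `M / δ + 1 ≤ R`. [folklore] -/
theorem mem_ballInf_of_norm_pos_le {δ M : ℝ} (hδ : 0 < δ) {R : ℕ} (hR : M / δ + 1 ≤ R) {v : Site 2}
    (hv : ‖pos δ v‖ ≤ M) : v ∈ ballInf 0 R ∧ v + ![0, -1] ∈ ballInf 0 R := by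
  have hn : ‖pos δ v‖ = δ * ‖sqEmb v‖ := by
    rw [pos, norm_mul, Complex.norm_real, Real.norm_eq_abs, abs_of_pos hδ]
  have hs : ‖sqEmb v‖ + 1 ≤ R := by
    have h1 : ‖sqEmb v‖ ≤ M / δ := by
      rw [le_div_iff₀ hδ]; nlinarith [norm_nonneg (sqEmb v)]
    linarith
  obtain ⟨h0, h1⟩ := abs_coord_le_norm_sqEmb v
  have c0 : |v 0| ≤ (R : ℤ) := by
    have : ((|v 0| : ℤ) : ℝ) ≤ (R : ℝ) := by push_cast; linarith
    exact_mod_cast this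
  have c1 : |v 1| ≤ (R : ℤ) := by
    have : ((|v 1| : ℤ) : ℝ) ≤ (R : ℝ) := by push_cast; linarith
    exact_mod_cast this
  have c1' : |v 1 - 1| ≤ (R : ℤ) := by
    have : ((|v 1| : ℤ) : ℝ) + 1 ≤ (R : ℝ) := by push_cast; linarith
    have h' : |v 1| + 1 ≤ (R : ℤ) := by exact_mod_cast this
    have h'' : |v 1| ≤ (R : ℤ) - 1 := by linarith
    rw [abs_le] at h'' ⊢
    omega
  simp only [ballInf, Set.mem_setOf_eq, Pi.zero_apply, sub_zero, Pi.add_apply, Matrix.cons_val_zero,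
    Matrix.cons_val_one, Matrix.cons_val_fin_one, add_zero]
  refine ⟨⟨c0, c1⟩, c0, ?_⟩
  simpa only [sub_eq_add_neg] using c1'

/-- Adjacency in the triangulation only reads the faces at the two cells and below them. [folklore] -/
theorem cellGraph_adj_congr {A A' : Set (Site 2)} {u v : Site 2}
    (hu : u ∈ A ↔ u ∈ A') (hu' : u + ![0, -1] ∈ A ↔ u + ![0, -1] ∈ A')
    (hv : v ∈ A ↔ v ∈ A') (hv' : v + ![0, -1] ∈ A ↔ v + ![0, -1] ∈ A') :
    (cellGraph A).Adj u v ↔ (cellGraph A').Adj u v := by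
  simp only [cellGraph, SimpleGraph.fromRel_adj, hu, hu', hv, hv']

/-- Monochromatic paths are read on any set containing their cells and the faces below them. [folklore] -/
theorem monoPaths_congr {Λ : Set (Site 2)} {x y : Obs} (h : Agree Λ x y) {b : Bool}
    {p : List (Site 2)} (hp : ∀ v ∈ p, v ∈ Λ ∧ v + ![0, -1] ∈ Λ) (hm : p ∈ monoPaths x b) :
    p ∈ monoPaths y b := by
  obtain ⟨hne, hc, hcol⟩ := hm
  refine ⟨hne, ?_, fun v hv => ?_⟩
  · refine List.IsChain.imp_of_mem_imp (fun u v hu hv huv => ?_) hc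
    exact (cellGraph_adj_congr (h u (hp u hu).1).2 (h _ (hp u hu).2).2 (h v (hp v hv).1).2
      (h _ (hp v hv).2).2).1 huv
  · rw [← (h v (hp v hv).1).1]; exact hcol v hv

/-- One direction of the bad event: a long window path of `x` without shadow in `x'`. [folklore] -/
def badDir (K : ℂ ≃L[ℝ] ℂ) (δ ε ρ : ℝ) (b : Bool) (x x' : Obs) : Prop :=
  ∃ p ∈ monoPaths x b, (∀ v ∈ p, ‖pos δ v‖ ≤ ρ) ∧ (∃ v ∈ p, ∃ w ∈ p, ε ≤ ‖pos δ v - pos δ w‖) ∧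
    ∀ p' ∈ monoPaths x' b, p' ∉ shadows K δ ε p

/-- Cells of a shadow of a window path are not far. [folklore] -/
theorem norm_pos_le_of_mem_shadows {K : ℂ ≃L[ℝ] ℂ} {δ ε ρ : ℝ} {p p' : List (Site 2)}
    (hp : ∀ v ∈ p, ‖pos δ v‖ ≤ ρ) (hs : p' ∈ shadows K δ ε p) {w : Site 2} (hw : w ∈ p') :
    ‖pos δ w‖ ≤ ε + ‖(K : ℂ →L[ℝ] ℂ)‖ * |ρ| := by
  obtain ⟨v, hv, hd⟩ := hs.2.1 w hw
  have h1 : ‖pos δ w‖ ≤ ‖pos δ w - K (pos δ v)‖ + ‖K (pos δ v)‖ := norm_le_norm_sub_add _ _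
  have h2 : ‖K (pos δ v)‖ ≤ ‖(K : ℂ →L[ℝ] ℂ)‖ * ‖pos δ v‖ := (K : ℂ →L[ℝ] ℂ).le_opNorm _
  have h3 : ‖pos δ v‖ ≤ |ρ| := (hp v hv).trans (le_abs_self ρ)
  nlinarith [norm_nonneg (K : ℂ →L[ℝ] ℂ)]

/-- Transfer of one direction of the bad event along window agreement. [folklore] -/
theorem badDir_transfer {K : ℂ ≃L[ℝ] ℂ} {δ ε ρ : ℝ} (hδ : 0 < δ) {R : ℕ}
    (hR₁ : |ρ| / δ + 1 ≤ R) (hR₂ : (ε + ‖(K : ℂ →L[ℝ] ℂ)‖ * |ρ|) / δ + 1 ≤ R)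
    {x y x' y' : Obs} (hxy : Agree (ballInf 0 R) x y) (hxy' : Agree (ballInf 0 R) x' y') {b : Bool}
    (h : badDir K δ ε ρ b x x') : badDir K δ ε ρ b y y' := by
  obtain ⟨p, hp, hwin, hdiam, hno⟩ := h
  have hpΛ : ∀ v ∈ p, v ∈ ballInf 0 R ∧ v + ![0, -1] ∈ ballInf 0 R := fun v hv =>
    mem_ballInf_of_norm_pos_le hδ hR₁ ((hwin v hv).trans (le_abs_self ρ))
  refine ⟨p, monoPaths_congr hxy hpΛ hp, hwin, hdiam, fun p' hp' hs => ?_⟩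
  have hp'Λ : ∀ w ∈ p', w ∈ ballInf 0 R ∧ w + ![0, -1] ∈ ballInf 0 R := fun w hw =>
    mem_ballInf_of_norm_pos_le hδ hR₂ (norm_pos_le_of_mem_shadows hwin hs hw)
  exact hno p' (monoPaths_congr hxy'.symm hp'Λ hp') hs

/-- The block scale at which the bad event is read. [folklore] -/
def liftScale (K : ℂ ≃L[ℝ] ℂ) (ε ρ : ℝ) : ℝ :=
  |ε| + (‖(K : ℂ →L[ℝ] ℂ)‖ + ‖(K.symm : ℂ →L[ℝ] ℂ)‖ + 1) * |ρ| + 2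

/-- The block scale is positive. [folklore] -/
theorem liftScale_pos (K : ℂ ≃L[ℝ] ℂ) (ε ρ : ℝ) : 0 < liftScale K ε ρ := by
  unfold liftScale; positivity

/-- The radius bounds packaged. [folklore] -/
theorem liftScale_bounds (K : ℂ ≃L[ℝ] ℂ) (ε ρ : ℝ) {δ : ℝ} (hδ : 0 < δ) (hδ1 : δ ≤ 1) :
    |ρ| / δ + 1 ≤ (⌈liftScale K ε ρ / δ⌉₊ : ℝ) ∧
    (ε + ‖(K : ℂ →L[ℝ] ℂ)‖ * |ρ|) / δ + 1 ≤ (⌈liftScale K ε ρ / δ⌉₊ : ℝ) ∧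
    (ε + ‖(K.symm : ℂ →L[ℝ] ℂ)‖ * |ρ|) / δ + 1 ≤ (⌈liftScale K ε ρ / δ⌉₊ : ℝ) := by
  have hc : liftScale K ε ρ / δ ≤ (⌈liftScale K ε ρ / δ⌉₊ : ℝ) := Nat.le_ceil _
  have hK : 0 ≤ ‖(K : ℂ →L[ℝ] ℂ)‖ := norm_nonneg _
  have hK' : 0 ≤ ‖(K.symm : ℂ →L[ℝ] ℂ)‖ := norm_nonneg _
  have hρ : 0 ≤ |ρ| := abs_nonneg ρ
  have hε : ε ≤ |ε| := le_abs_self ε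
  have hε0 : 0 ≤ |ε| := abs_nonneg ε
  have p1 : 0 ≤ ‖(K : ℂ →L[ℝ] ℂ)‖ * |ρ| := mul_nonneg hK hρ
  have p2 : 0 ≤ ‖(K.symm : ℂ →L[ℝ] ℂ)‖ * |ρ| := mul_nonneg hK' hρ
  have key : ∀ t : ℝ, t + δ ≤ liftScale K ε ρ → t / δ + 1 ≤ (⌈liftScale K ε ρ / δ⌉₊ : ℝ) := by
    intro t ht
    have : t / δ + 1 = (t + δ) / δ := by field_simp
    rw [this]
    exact (div_le_div_of_nonneg_right ht hδ.le).trans hc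
  refine ⟨key _ ?_, key _ ?_, key _ ?_⟩ <;> unfold liftScale <;> nlinarith

/-- **THE BAD EVENT IS READ ON THE WINDOW** (registered sub-goal): pairs of observable configurations
agreeing on the sup-ball of radius `⌈liftScale K ε ρ / δ⌉` lie in `badObs K δ ε ρ` together. [folklore] -/
theorem badObs_congr :
    ∀ (K : ℂ ≃L[ℝ] ℂ) (ε ρ : ℝ) {δ : ℝ}, 0 < δ → δ ≤ 1 → ∀ {x y x' y' : Obs},
      Lift.Agree (ballInf 0 ⌈Lift.liftScale K ε ρ / δ⌉₊) x y →
      Lift.Agree (ballInf 0 ⌈Lift.liftScale K ε ρ / δ⌉₊) x' y' →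
      ((x, x') ∈ badObs K δ ε ρ ↔ (y, y') ∈ badObs K δ ε ρ) := by
  intro K ε ρ δ hδ hδ1 x y x' y' hxy hxy'
  obtain ⟨h₁, h₂, h₃⟩ := liftScale_bounds K ε ρ hδ hδ1
  change (∃ b, badDir K δ ε ρ b x x' ∨ badDir K.symm δ ε ρ b x' x) ↔
    (∃ b, badDir K δ ε ρ b y y' ∨ badDir K.symm δ ε ρ b y' y)
  refine exists_congr fun b => or_congr ⟨fun h => ?_, fun h => ?_⟩ ⟨fun h => ?_, fun h => ?_⟩
  · exact badDir_transfer hδ h₁ h₂ hxy hxy' h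
  · exact badDir_transfer hδ h₁ h₂ hxy.symm hxy'.symm h
  · exact badDir_transfer hδ h₁ h₃ hxy' hxy h
  · exact badDir_transfer hδ h₁ h₃ hxy'.symm hxy.symm h

/-! ## Part B (begun) — arithmetic and measurability helpers for the gluing formula -/

/-- `a * (a⁻¹ * m) = m` in `ℝ≥0∞` as soon as `m ≤ a < ∞`. [folklore] -/
theorem ennreal_mul_inv_mul {a m : ℝ≥0∞} (hle : m ≤ a) (ha : a ≠ ∞) : a * (a⁻¹ * m) = m := by
  by_cases h0 : a = 0
  · have hm : m = 0 := le_zero_iff.1 (h0 ▸ hle)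
    simp only [h0, hm, mul_zero]
  · rw [← mul_assoc, ENNReal.mul_inv_cancel h0 ha, one_mul]

/-- Rearrangement used for the first marginal. [folklore] -/
theorem ennreal_rearr_fst {p a b m : ℝ≥0∞} (hle : p ≤ b) (hb : b ≠ ∞) :
    p * (a⁻¹ * b⁻¹) * (b * m) = p * (a⁻¹ * m) := by
  by_cases h0 : b = 0
  · have hp : p = 0 := le_zero_iff.1 (h0 ▸ hle)
    simp only [hp, zero_mul]
  · calc p * (a⁻¹ * b⁻¹) * (b * m) = p * (a⁻¹ * m) * (b⁻¹ * b) := by ring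
      _ = p * (a⁻¹ * m) := by rw [ENNReal.inv_mul_cancel h0 hb, mul_one]

/-- Rearrangement used for the second marginal. [folklore] -/
theorem ennreal_rearr_snd {p a b m : ℝ≥0∞} (hle : p ≤ a) (ha : a ≠ ∞) :
    p * (a⁻¹ * b⁻¹) * (a * m) = p * (b⁻¹ * m) := by
  by_cases h0 : a = 0
  · have hp : p = 0 := le_zero_iff.1 (h0 ▸ hle)
    simp only [hp, zero_mul]
  · calc p * (a⁻¹ * b⁻¹) * (a * m) = p * (b⁻¹ * m) * (a⁻¹ * a) := by ring
      _ = p * (b⁻¹ * m) := by rw [ENNReal.inv_mul_cancel h0 ha, mul_one]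

/-- `(a⁻¹ b⁻¹)(a b) ≤ 1` in `ℝ≥0∞`. [folklore] -/
theorem ennreal_inv_inv_mul_mul_le_one (a b : ℝ≥0∞) : a⁻¹ * b⁻¹ * (a * b) ≤ 1 := by
  calc a⁻¹ * b⁻¹ * (a * b) = (a⁻¹ * a) * (b⁻¹ * b) := by ring
    _ ≤ 1 := mul_le_one' (ENNReal.inv_mul_le_one _) (ENNReal.inv_mul_le_one _)

/-- Measurability of `a ↦ (p a ↔ c)` for a measurable proposition `p` and a constant `c`. [folklore] -/
theorem measurable_iff_const {α : Type*} [MeasurableSpace α] {p : α → Prop} (hp : Measurable p)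
    (c : Prop) : Measurable fun a => (p a ↔ c) := by
  by_cases hc : c
  · simp only [hc, iff_true]; exact hp
  · simp only [hc, iff_false]; exact hp.not

end Lift

end Summit.CriticalPhenomena.CardyFormulaZ2.Theorems.IKLinearTransport.PinnedDiagramExchange

end
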